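import Summits.ValiantsHypothesis.ValiantsHypothesis.Theorems.BarrierLeverPartitionMinorsHitByVPOfLowerSetsDoors

/-!
# Route BarrierLever — item `PartitionMinorsHitByVP` (stmt-ValiantsHypothesis-19717):
# the BI-ADDITIVE door — the PRODUCT of the additive witness and its mirror

Link file (`--supports stmt-ValiantsHypothesis-19717`; cell valiant-natproofs, rung V4, 𝒟-side door
(c); prover seat val-np-p1 gen 12). Definition-free. Closes NO item: it reduces item 19717 BY NAME to
the generic nonsingularity of ONE explicit two-table matrix family on every (simplicial-complex) layout.

**The witness.** With val-np-p6's additive witness `F(ω₀, ω) = ∏_c (1 + ω₀ c y_c) ∏_a (1 + x_a ∏_c (1 + ω a c y_c))`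
(`AdditiveDoor.coeff_additiveWitness`: partition matrix `A[S,T] = ∏_{c∈T} (ω₀ c + Σ_{a∈S} ω a c)`) and its
`x ↔ y` mirror `swap F(ω₀', ω')` (`coeff_additiveWitness_swap`: `B[S,T] = ∏_{a∈S} (ω₀' a + Σ_{c∈T} ω' c a)`),
the SUM door of record v6 uses `F + swap F'` (matrix `A + B`). THIS door uses the PRODUCT
`P = F(ω₀, ω) · swap F(ω₀', ω')`: by the convolution formula for partition coefficients
(`coeff_partitionExpo_mul`: `coeff_{x^U y^W}(f g) = Σ_{S⊆U, T⊆W} coeff_{x^S y^T} f · coeff_{x^{U∖S} y^{W∖T}} g`,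
any `f, g`) its partition matrix is the BI-ADDITIVE matrix
`P[U,W] = Σ_{S ⊆ U} Σ_{T ⊆ W} A[S,T] · B[U∖S, W∖T]` (`coeff_biadditiveWitness`). Same size as the sum witness
(`≤ 6h²+12h+3`), degree truncated to `2h` inside `SmallCircuits ℂ (h+h) 5` for `h ≥ 3`.

In the zeon algebra `ℂ[x,y]/(x_a², y_c²)` the witness is `exp(Σ_a x_a β_a(y) + Σ_c y_c α_c(x))` times units,
`β_a = ∏_c (1 + ω a c y_c) − 1`, `α_c = ∏_a (1 + ω' c a x_a) − 1`: its coefficients count covers of `U ⊔ W` by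
vertex-disjoint STARS centred on either side — it raises AND lowers cardinality, so neither the Hilbert
(f-vector) obstruction of the one-sided additive doors (`…AdditiveDoubleObstruction`) nor the even-cycle
obstruction of the matching/permanental-compound structure applies.

**Results.**
* `coeff_partitionExpo_mul` — the convolution formula (any commutative semiring, any `f, g`).
* `coeff_biadditiveWitness` — the partition matrix of `F · swap F'`.
* `partitionMinor_hit_of_biadditive` / `…_mem` — THE DOOR: `det P[u,w] ≠ 0` for some tables ⇒ the layout is
  hit (explicit size; inside `SmallCircuits ℂ (h+h) 5` for `h ≥ 3`).
* `partitionMinorsHitByVP_of_biadditive` — arrow onto the route declaration (`b = 5`, `h₀ = 3`);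
  `partitionMinorsHitByVP_of_biadditive_lowerSets` — by the lower-set reduction
  (`DownCompression.partitionMinorsHitByVP_of_lowerSets`) the hypothesis is needed on SIMPLICIAL-COMPLEX
  pairs only (`b = 9`).

**Evidence (seat numerics, exact mod 2⁶¹−1, 2–3 random table pairs; scripts HOME/val-np-p1/g12/lab/).**
By the lower-set reduction and independent relabellings of `x` and `y`, item 19717 at height `h` is decided
on pairs of isomorphism TYPES of simplicial complexes of equal face number: the bi-additive matrix is
nonsingular on ALL 54 pairs at `h = 3`, all 64 type pairs (2 590 ordered pairs) at `h = 4`, ALL 2 112 type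
pairs at `h = 5` (= every injective layout of height `≤ 5`), 2 000 random complex pairs at `h = 6`, 300 at
`h = 7` (0 failures); and on the doubly obstructed pairs where BOTH one-sided additive matrices vanish:
star `K_{1,4}` versus `C₄ ⊔ pt` (`h = 5`, `r = 10`, equal f-vectors — the permanental-compound/even-cycle
obstruction) and `2^[3] ⊔ 4 pts` versus the `K_{2,3}` complex (`h = 7`, `r = 12`, crossing f-vectors).
The one-sided additive matrix alone dies on 13 of the 64 type pairs at `h = 4`.

WHAT THIS IS NOT: the hypothesis «det P ≠ 0 for some tables, on every injective (lower-set) layout» is an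
OPEN conjecture with the census above, of the same logical shape as the SUM door / Q\* / CPM; nothing is
claimed about it, about crux stmt-ValiantsHypothesis-14610, or about `VP` versus `VNP`.
-/

set_option linter.dupNamespace false

namespace Summit.ValiantsHypothesis.ValiantsHypothesis.Theorems.BarrierLever.BiadditiveDoor

open Finset MvPolynomial
open Literature.Barriers.ValiantsHypothesis Literature.Computability.AlgebraicComplexity
open Summit.ValiantsHypothesis.ValiantsHypothesis.Theorems.BarrierLever.ProductStateSums
  (castAdd_ne_natAdd partitionExpo_apply_castAdd partitionExpo_apply_natAdd)
open Summit.ValiantsHypothesis.ValiantsHypothesis.Theorems.BarrierLever.AdditiveDoor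
  (coeff_additiveWitness coeff_additiveWitness_swap complexity_additiveWitness_le truncation_spec
    degree_partitionExpo_le)

noncomputable section

variable {h : ℕ}

/-! ## 1. Convolution of partition coefficients -/

/-- Splitting a partition exponent along sub-layouts: `x^S y^T · x^{U∖S} y^{W∖T} = x^U y^W`. -/
theorem partitionExpo_add_sdiff (U W S T : Finset (Fin h)) (hS : S ⊆ U) (hT : T ⊆ W) :
    (∑ a ∈ S, Finsupp.single (Fin.castAdd h a) 1 + ∑ c ∈ T, Finsupp.single (Fin.natAdd h c) 1 :
      Fin (h + h) →₀ ℕ) +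
      (∑ a ∈ U \ S, Finsupp.single (Fin.castAdd h a) 1 + ∑ c ∈ W \ T, Finsupp.single (Fin.natAdd h c) 1) =
      ∑ a ∈ U, Finsupp.single (Fin.castAdd h a) 1 + ∑ c ∈ W, Finsupp.single (Fin.natAdd h c) 1 := by
  rw [add_add_add_comm, add_comm (∑ a ∈ S, _), add_comm (∑ c ∈ T, _), Finset.sum_sdiff hS,
    Finset.sum_sdiff hT]

/-- **Convolution formula.** For ANY polynomials `f, g`, the `x^U y^W`-coefficient of `f · g` is
`Σ_{S ⊆ U} Σ_{T ⊆ W} coeff_{x^S y^T} f · coeff_{x^{U∖S} y^{W∖T}} g` (the antidiagonal of a square-free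
exponent consists of the complementary pairs of its sub-exponents). -/
theorem coeff_partitionExpo_mul {R : Type*} [CommSemiring R] (f g : MvPolynomial (Fin (h + h)) R)
    (U W : Finset (Fin h)) :
    coeff (∑ a ∈ U, Finsupp.single (Fin.castAdd h a) 1 + ∑ c ∈ W, Finsupp.single (Fin.natAdd h c) 1)
        (f * g) =
      ∑ S ∈ U.powerset, ∑ T ∈ W.powerset,
        coeff (∑ a ∈ S, Finsupp.single (Fin.castAdd h a) 1 + ∑ c ∈ T, Finsupp.single (Fin.natAdd h c) 1) f *
        coeff (∑ a ∈ U \ S, Finsupp.single (Fin.castAdd h a) 1 +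
          ∑ c ∈ W \ T, Finsupp.single (Fin.natAdd h c) 1) g := by
  classical
  rw [coeff_mul, ← Finset.sum_product']
  symm
  refine Finset.sum_nbij'
    (fun p : Finset (Fin h) × Finset (Fin h) =>
      ((∑ a ∈ p.1, Finsupp.single (Fin.castAdd h a) 1 + ∑ c ∈ p.2, Finsupp.single (Fin.natAdd h c) 1 :
          Fin (h + h) →₀ ℕ),
        (∑ a ∈ U \ p.1, Finsupp.single (Fin.castAdd h a) 1 +
          ∑ c ∈ W \ p.2, Finsupp.single (Fin.natAdd h c) 1 : Fin (h + h) →₀ ℕ)))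
    (fun x : (Fin (h + h) →₀ ℕ) × (Fin (h + h) →₀ ℕ) =>
      (U.filter (fun a => x.1 (Fin.castAdd h a) ≠ 0), W.filter (fun c => x.1 (Fin.natAdd h c) ≠ 0)))
    ?_ ?_ ?_ ?_ (fun _ _ => rfl)
  · -- lands in the antidiagonal
    rintro ⟨S, T⟩ hp
    rw [Finset.mem_product, Finset.mem_powerset, Finset.mem_powerset] at hp
    exact Finset.HasAntidiagonal.mem_antidiagonal.mpr (partitionExpo_add_sdiff U W S T hp.1 hp.2)
  · -- the filters are sub-layouts
    rintro ⟨n₁, n₂⟩ _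
    rw [Finset.mem_product, Finset.mem_powerset, Finset.mem_powerset]
    exact ⟨Finset.filter_subset _ _, Finset.filter_subset _ _⟩
  · -- left inverse
    rintro ⟨S, T⟩ hp
    rw [Finset.mem_product, Finset.mem_powerset, Finset.mem_powerset] at hp
    refine Prod.ext ?_ ?_
    · ext a
      simp only [Finset.mem_filter]
      rw [partitionExpo_apply_castAdd]
      constructor
      · rintro ⟨-, ha⟩; by_contra haS; exact ha (if_neg haS)
      · intro haS; exact ⟨hp.1 haS, by rw [if_pos haS]; exact one_ne_zero⟩
    · ext c
      simp only [Finset.mem_filter]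
      rw [partitionExpo_apply_natAdd]
      constructor
      · rintro ⟨-, hc⟩; by_contra hcT; exact hc (if_neg hcT)
      · intro hcT; exact ⟨hp.2 hcT, by rw [if_pos hcT]; exact one_ne_zero⟩
  · -- right inverse
    rintro ⟨n₁, n₂⟩ hx'
    have hx : n₁ + n₂ = (∑ a ∈ U, Finsupp.single (Fin.castAdd h a) 1 +
        ∑ c ∈ W, Finsupp.single (Fin.natAdd h c) 1 : Fin (h + h) →₀ ℕ) :=
      Finset.HasAntidiagonal.mem_antidiagonal.mp hx'
    -- pointwise values of `n₁ + n₂ = E U W`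
    have hval_x : ∀ a, n₁ (Fin.castAdd h a) + n₂ (Fin.castAdd h a) = if a ∈ U then 1 else 0 := by
      intro a
      have := congrArg (fun n : Fin (h + h) →₀ ℕ => n (Fin.castAdd h a)) hx
      simp only [Finsupp.add_apply] at this
      rw [this]
      exact partitionExpo_apply_castAdd U W a
    have hval_y : ∀ c, n₁ (Fin.natAdd h c) + n₂ (Fin.natAdd h c) = if c ∈ W then 1 else 0 := by
      intro c
      have := congrArg (fun n : Fin (h + h) →₀ ℕ => n (Fin.natAdd h c)) hx
      simp only [Finsupp.add_apply] at this
      rw [this]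
      exact partitionExpo_apply_natAdd U W c
    have h1 : (∑ a ∈ U.filter (fun a => n₁ (Fin.castAdd h a) ≠ 0), Finsupp.single (Fin.castAdd h a) 1 +
        ∑ c ∈ W.filter (fun c => n₁ (Fin.natAdd h c) ≠ 0), Finsupp.single (Fin.natAdd h c) 1 :
          Fin (h + h) →₀ ℕ) = n₁ := by
      ext v
      refine Fin.addCases (fun a => ?_) (fun c => ?_) v
      · rw [partitionExpo_apply_castAdd]
        have hv := hval_x a
        by_cases haU : a ∈ U
        · rw [if_pos haU] at hv
          by_cases hn : n₁ (Fin.castAdd h a) = 0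
          · have hnot : a ∉ U.filter (fun a => n₁ (Fin.castAdd h a) ≠ 0) :=
              fun hm => (Finset.mem_filter.mp hm).2 hn
            rw [if_neg hnot, hn]
          · rw [if_pos (Finset.mem_filter.mpr ⟨haU, hn⟩)]; omega
        · rw [if_neg haU] at hv
          rw [if_neg (fun hm => haU (Finset.mem_filter.mp hm).1)]; omega
      · rw [partitionExpo_apply_natAdd]
        have hv := hval_y c
        by_cases hcW : c ∈ W
        · rw [if_pos hcW] at hv
          by_cases hn : n₁ (Fin.natAdd h c) = 0
          · have hnot : c ∉ W.filter (fun c => n₁ (Fin.natAdd h c) ≠ 0) :=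
              fun hm => (Finset.mem_filter.mp hm).2 hn
            rw [if_neg hnot, hn]
          · rw [if_pos (Finset.mem_filter.mpr ⟨hcW, hn⟩)]; omega
        · rw [if_neg hcW] at hv
          rw [if_neg (fun hm => hcW (Finset.mem_filter.mp hm).1)]; omega
    have h12 := partitionExpo_add_sdiff U W (U.filter (fun a => n₁ (Fin.castAdd h a) ≠ 0))
      (W.filter (fun c => n₁ (Fin.natAdd h c) ≠ 0)) (Finset.filter_subset _ _) (Finset.filter_subset _ _)
    rw [h1] at h12
    refine Prod.ext h1 ?_
    -- second components: both are `E U W - n₁`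
    have h2 := congrArg (fun n => n - n₁) h12
    have hx2 := congrArg (fun n => n - n₁) hx
    simp only [add_tsub_cancel_left] at h2 hx2
    rw [h2, ← hx2]

/-! ## 2. The bi-additive witness and its partition matrix -/

/-- **Coefficients of the bi-additive witness** `F(ω₀, ω) · swap F(ω₀', ω')`:
`coeff_{x^U y^W} = Σ_{S ⊆ U} Σ_{T ⊆ W} ∏_{c∈T} (ω₀ c + Σ_{a∈S} ω a c) · ∏_{a ∈ U∖S} (ω₀' a + Σ_{c ∈ W∖T} ω' c a)`. -/
theorem coeff_biadditiveWitness (ω₀ : Fin h → ℂ) (ω : Fin h → Fin h → ℂ) (ω₀' : Fin h → ℂ)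
    (ω' : Fin h → Fin h → ℂ) (U W : Finset (Fin h)) :
    coeff (∑ a ∈ U, Finsupp.single (Fin.castAdd h a) 1 + ∑ c ∈ W, Finsupp.single (Fin.natAdd h c) 1)
      (((∏ c : Fin h, (1 + C (ω₀ c) * X (Fin.natAdd h c))) *
          ∏ a : Fin h, (1 + X (Fin.castAdd h a) * ∏ c : Fin h, (1 + C (ω a c) * X (Fin.natAdd h c)))) *
        rename (finSumFinEquiv.symm.trans ((Equiv.sumComm (Fin h) (Fin h)).trans finSumFinEquiv))
          ((∏ c : Fin h, (1 + C (ω₀' c) * X (Fin.natAdd h c))) *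
            ∏ a : Fin h, (1 + X (Fin.castAdd h a) *
              ∏ c : Fin h, (1 + C (ω' a c) * X (Fin.natAdd h c))) : MvPolynomial (Fin (h + h)) ℂ)) =
      ∑ S ∈ U.powerset, ∑ T ∈ W.powerset,
        (∏ c ∈ T, (ω₀ c + ∑ a ∈ S, ω a c)) * ∏ a ∈ U \ S, (ω₀' a + ∑ c ∈ W \ T, ω' c a) := by
  rw [coeff_partitionExpo_mul]
  refine Finset.sum_congr rfl fun S _ => Finset.sum_congr rfl fun T _ => ?_
  rw [coeff_additiveWitness, coeff_additiveWitness_swap]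

/-! ## 3. Size, truncation, and the door -/

/-- **THE BI-ADDITIVE DOOR (explicit size).** If some pair of tables makes the bi-additive matrix
`[Σ_{S ⊆ u i, T ⊆ w j} ∏_{c∈T}(ω₀ c + Σ_{a∈S} ω a c) · ∏_{a∈u i∖S}(ω₀' a + Σ_{c∈w j∖T} ω' c a)]_{i,j}`
nonsingular, the layout `(u, w)` has a nonsingular partition matrix at some `f` with `deg f ≤ 2h` and
`L(f) ≤ (2h+2)²(6h²+12h+3) + 2h + 1`. -/
theorem partitionMinor_hit_of_biadditive {ι : Type*} [Fintype ι] [DecidableEq ι] (h : ℕ)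
    (u w : ι → Finset (Fin h)) (ω₀ : Fin h → ℂ) (ω : Fin h → Fin h → ℂ)
    (ω₀' : Fin h → ℂ) (ω' : Fin h → Fin h → ℂ)
    (hdet : (Matrix.of fun i j : ι => ∑ S ∈ (u i).powerset, ∑ T ∈ (w j).powerset,
      (∏ c ∈ T, (ω₀ c + ∑ a ∈ S, ω a c)) * ∏ a ∈ u i \ S, (ω₀' a + ∑ c ∈ w j \ T, ω' c a)).det ≠ 0) :
    ∃ f : MvPolynomial (Fin (h + h)) ℂ, f.totalDegree ≤ h + h ∧
      complexity f ≤ (h + h + 2) ^ 2 * (6 * h * h + 12 * h + 3) + (h + h + 1) ∧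
      (Matrix.of fun i j : ι => MvPolynomial.coeff
        (∑ a ∈ u i, Finsupp.single (Fin.castAdd h a) 1 +
          ∑ c ∈ w j, Finsupp.single (Fin.natAdd h c) 1) f).det ≠ 0 := by
  set τ := finSumFinEquiv.symm.trans ((Equiv.sumComm (Fin h) (Fin h)).trans finSumFinEquiv) with hτ
  set F : MvPolynomial (Fin (h + h)) ℂ := (∏ c : Fin h, (1 + C (ω₀ c) * X (Fin.natAdd h c))) *
    ∏ a : Fin h, (1 + X (Fin.castAdd h a) * ∏ c : Fin h, (1 + C (ω a c) * X (Fin.natAdd h c)))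
    with hF
  set F' : MvPolynomial (Fin (h + h)) ℂ := (∏ c : Fin h, (1 + C (ω₀' c) * X (Fin.natAdd h c))) *
    ∏ a : Fin h, (1 + X (Fin.castAdd h a) * ∏ c : Fin h, (1 + C (ω' a c) * X (Fin.natAdd h c)))
    with hF'
  set G : MvPolynomial (Fin (h + h)) ℂ := F * rename τ F' with hG
  have hsizeG : complexity G ≤ 6 * h * h + 12 * h + 3 := by
    calc complexity G ≤ complexity F + complexity (rename τ F') + 1 := complexity_mul_le_holds _ _
      _ ≤ (3 * h * h + 6 * h + 1) + (3 * h * h + 6 * h + 1) + 1 := by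
          gcongr
          · exact complexity_additiveWitness_le ω₀ ω
          · exact (complexity_rename_le_holds' _ _).trans (complexity_additiveWitness_le ω₀' ω')
      _ = 6 * h * h + 12 * h + 3 := by ring
  obtain ⟨hdeg, hcoeff, hsize⟩ := truncation_spec G (h + h)
  refine ⟨∑ e ∈ Finset.range (h + h + 1), homogeneousComponent e G, hdeg, ?_, ?_⟩
  · exact hsize.trans (by gcongr)
  · have hmat : (Matrix.of fun i j : ι => MvPolynomial.coeff
        (∑ a ∈ u i, Finsupp.single (Fin.castAdd h a) 1 +
          ∑ c ∈ w j, Finsupp.single (Fin.natAdd h c) 1)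
        (∑ e ∈ Finset.range (h + h + 1), homogeneousComponent e G)) =
        Matrix.of fun i j : ι => ∑ S ∈ (u i).powerset, ∑ T ∈ (w j).powerset,
          (∏ c ∈ T, (ω₀ c + ∑ a ∈ S, ω a c)) * ∏ a ∈ u i \ S, (ω₀' a + ∑ c ∈ w j \ T, ω' c a) := by
      ext i j
      rw [Matrix.of_apply, Matrix.of_apply, hcoeff _ (degree_partitionExpo_le _ _), hG, hF, hF', hτ,
        coeff_biadditiveWitness]
    rw [hmat]
    exact hdet

/-- **THE BI-ADDITIVE DOOR (class form).** For `h ≥ 3` the bi-additive witness lies in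
`SmallCircuits ℂ (h+h) 5`. -/
theorem partitionMinor_hit_of_biadditive_mem {ι : Type*} [Fintype ι] [DecidableEq ι] (h : ℕ)
    (hh : 3 ≤ h) (u w : ι → Finset (Fin h)) (ω₀ : Fin h → ℂ) (ω : Fin h → Fin h → ℂ)
    (ω₀' : Fin h → ℂ) (ω' : Fin h → Fin h → ℂ)
    (hdet : (Matrix.of fun i j : ι => ∑ S ∈ (u i).powerset, ∑ T ∈ (w j).powerset,
      (∏ c ∈ T, (ω₀ c + ∑ a ∈ S, ω a c)) * ∏ a ∈ u i \ S, (ω₀' a + ∑ c ∈ w j \ T, ω' c a)).det ≠ 0) :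
    ∃ f ∈ SmallCircuits ℂ (h + h) 5,
      (Matrix.of fun i j : ι => MvPolynomial.coeff
        (∑ a ∈ u i, Finsupp.single (Fin.castAdd h a) 1 +
          ∑ c ∈ w j, Finsupp.single (Fin.natAdd h c) 1) f).det ≠ 0 := by
  obtain ⟨f, hdeg, hsize, hf⟩ := partitionMinor_hit_of_biadditive h u w ω₀ ω ω₀' ω' hdet
  refine ⟨f, ⟨hdeg, hsize.trans ?_⟩, hf⟩
  have e1 : 3 * (h + h + 2) ≤ 8 * h := by omega
  have e2 : 6 * h * h + 12 * h + 3 ≤ 11 * h * h := by nlinarith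
  have e3 : 9 * (h + h + 1) ≤ 8 * (h * h * h * h) := by nlinarith
  nlinarith [e1, e2, e3, Nat.zero_le h]

/-! ## 4. The links to item 19717 -/

/-- **The bi-additive door.** If for every `h ≥ 3` and every injective layout `(u, w)` SOME pair of
additive tables makes the bi-additive matrix nonsingular, item 19717 `PartitionMinorsHitByVP` holds
(`b = 5`, `h₀ = 3`). -/
theorem partitionMinorsHitByVP_of_biadditive
    (hyp : ∀ h : ℕ, 3 ≤ h → ∀ (r : ℕ) (u w : Fin r → Finset (Fin h)),
      Function.Injective u → Function.Injective w →
      ∃ (ω₀ : Fin h → ℂ) (ω : Fin h → Fin h → ℂ) (ω₀' : Fin h → ℂ) (ω' : Fin h → Fin h → ℂ),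
        (Matrix.of fun i j : Fin r => ∑ S ∈ (u i).powerset, ∑ T ∈ (w j).powerset,
          (∏ c ∈ T, (ω₀ c + ∑ a ∈ S, ω a c)) * ∏ a ∈ u i \ S, (ω₀' a + ∑ c ∈ w j \ T, ω' c a)).det ≠ 0) :
    Summit.ValiantsHypothesis.ValiantsHypothesis.Theses.BarrierLever.PartitionMinorsHitByVP := by
  refine ⟨5, 3, fun h hh r u w hu hw => ?_⟩
  obtain ⟨ω₀, ω, ω₀', ω', hdet⟩ := hyp h hh r u w hu hw
  exact partitionMinor_hit_of_biadditive_mem h hh u w ω₀ ω ω₀' ω' hdet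

/-- **The bi-additive door on simplicial complexes.** By the lower-set reduction
(`DownCompression.partitionMinorsHitByVP_of_lowerSets`) the hypothesis is needed only for injective layouts
whose row family AND column family have lower-set ranges (`b = 9`). -/
theorem partitionMinorsHitByVP_of_biadditive_lowerSets
    (hyp : ∀ h : ℕ, 3 ≤ h → ∀ (r : ℕ) (u w : Fin r → Finset (Fin h)),
      Function.Injective u → Function.Injective w →
      IsLowerSet (Set.range u) → IsLowerSet (Set.range w) →
      ∃ (ω₀ : Fin h → ℂ) (ω : Fin h → Fin h → ℂ) (ω₀' : Fin h → ℂ) (ω' : Fin h → Fin h → ℂ),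
        (Matrix.of fun i j : Fin r => ∑ S ∈ (u i).powerset, ∑ T ∈ (w j).powerset,
          (∏ c ∈ T, (ω₀ c + ∑ a ∈ S, ω a c)) * ∏ a ∈ u i \ S, (ω₀' a + ∑ c ∈ w j \ T, ω' c a)).det ≠ 0) :
    Summit.ValiantsHypothesis.ValiantsHypothesis.Theses.BarrierLever.PartitionMinorsHitByVP := by
  refine DownCompression.partitionMinorsHitByVP_of_lowerSets ⟨5, 3, fun h hh r u w hu hw hlu hlw => ?_⟩
  obtain ⟨ω₀, ω, ω₀', ω', hdet⟩ := hyp h hh r u w hu hw hlu hlw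
  exact partitionMinor_hit_of_biadditive_mem h hh u w ω₀ ω ω₀' ω' hdet

end

end Summit.ValiantsHypothesis.ValiantsHypothesis.Theorems.BarrierLever.BiadditiveDoor
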